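import Literature.NumberTheory.GaloisRepresentations.NeukirchAbstractUniqueness
import Mathlib.Order.WellFounded
import Mathlib.Data.Set.Card
import HarnessLib

/-!
# Neukirch's characterisation of decomposition groups, abstract core II: existence

Topic `NumberTheory/GaloisRepresentations`; namespace
`Literature.NumberTheory.GaloisRepresentations.NeukirchAbstract`.  Proof file: theorems only (no
definition, no instance, no named fact).  Companion of `NeukirchAbstractUniqueness.lean` (same
conventions: one ambient profinite `Γ` acting on a set `P` of "primes" with stabilisers `D p`,
`ℓ`-torsion classes = locally constant `2`-cocycles `Γ → Γ → R` on subgroups, the coboundary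
predicate `Cob` bound together with its defining equivalence `hCob`).

Hypotheses of local-global type used here, at the open subgroups `V ≤ V₀`:
* (AxH) HASSE INJECTIVITY: a class on `V` which dies on `D p ∩ V` for every prime `p` dies on `V`
  — for `Γ_K`, `K` a number field: Albert–Brauer–Hasse–Noether for `H²(·, μ_ℓ) ⊆ Br` (the tree's
  `BrauerHassePrinciple.twoCocycle_cob_of_locallyTrivial`);
* (AxF) FINITE SUPPORT: a class on `V` is non-zero at primes over only finitely many "rational
  primes" `π p` (a Brauer class has finitely many non-zero local invariants);
* the fibres of `π` consist of finitely many `Γ`-orbits (finitely many primes of `K` over `p`).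

Results:
* `coboundary_stabilizer_smul_iff` — `T(V) = {p : y|_{D p ∩ V} ≠ 0}` is `V`-stable (inner
  automorphisms act trivially, `cocycle_conj_sub_coboundary`);
* `exists_mem_forall_of_subset_finite` — a directed family of non-empty subsets of a finite set has a
  common point;
* `exists_prime_forall_not_coboundary` — **EXISTENCE**: for a closed `H' ≤ V₀` and a class `x ≠ 0`
  on `H'`, there are an open `V₁ ⊇ H'`, an extension `y` of `x` to `V₁` and a prime `p` such that
  `y|_{D p ∩ V} ≠ 0` for EVERY open `H' ≤ V ≤ V₁` — the abstract form of "the set `S` of places of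
  `L = K̄^{H'}` with `Br(L_w)(ℓ) ≠ 0` is non-empty" in the proof of [NSW] Prop. (12.1.9) (Hasse
  injectivity at each finite level, finiteness of the support, compactness of the primes of `K̄`
  over a fixed rational prime).

HONEST FRAMING: classical (our kernel check); written for the abc-iut cell's GAP-LEDGER row
G-L4d2g4-1 (campaign L); nothing here bears on [IUTchIII] Cor. 3.12.

## References

* J. Neukirch, *Kennzeichnung der p-adischen und der endlichen algebraischen Zahlkörper*, Invent.
  Math. 6 (1969) 296–314. [Neukirch1969]
* J. Neukirch, A. Schmidt, K. Wingberg, *Cohomology of Number Fields* (2nd ed. 2008), XII §1,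
  Prop. (12.1.9). [NeukirchSchmidtWingberg2008]
-/

open Topology
open scoped Pointwise

universe u v w

namespace Literature.NumberTheory.GaloisRepresentations.NeukirchAbstract

open Literature.GroupTheory.LocallyConstantCocycles

variable {Γ : Type u} [Group Γ] [TopologicalSpace Γ]
variable {R : Type v} [Field R]

/-! ### A combinatorial lemma: directed families inside a finite set -/

/-- A family of non-empty subsets of a finite set which is directed under `⊇` has a common element
(take a member of minimal cardinality).  Used twice in the compactness step of [NSW] (12.1.9).
[cite: NeukirchSchmidtWingberg2008, Prop (12.1.9)] -/
theorem exists_mem_forall_of_subset_finite {α : Type*} {κ : Type*} [Nonempty κ] {Q : Set α}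
    (hQ : Q.Finite) (F : κ → Set α) (hF : ∀ k, F k ⊆ Q) (hne : ∀ k, (F k).Nonempty)
    (hdir : ∀ k k', ∃ m, F m ⊆ F k ∧ F m ⊆ F k') : ∃ a, ∀ k, a ∈ F k := by
  classical
  have hfin : ∀ k, (F k).Finite := fun k => hQ.subset (hF k)
  let k₀ := Function.argmin (fun k => (F k).ncard)
  have hmin : ∀ k, (F k₀).ncard ≤ (F k).ncard := fun k =>
    Function.argmin_le (fun k => (F k).ncard) k
  obtain ⟨a, ha⟩ := hne k₀
  refine ⟨a, fun k => ?_⟩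
  obtain ⟨m, hm₀, hmk⟩ := hdir k₀ k
  have heq : F m = F k₀ := Set.eq_of_subset_of_ncard_le hm₀ (hmin m) (hfin k₀)
  exact hmk (heq ▸ ha)

/-! ### Sets stable under an open subgroup are clopen -/

section Clopen

variable [IsTopologicalGroup Γ]

/-- A subset of a topological group which is stable under left multiplication by an open subgroup is
closed (its complement is a union of open translates). [cite: NeukirchSchmidtWingberg2008, Prop (12.1.9)] -/
theorem isClosed_of_forall_mul_mem_iff {V : Subgroup Γ} (hV : IsOpen (V : Set Γ)) {A : Set Γ}
    (h : ∀ v ∈ V, ∀ g, g ∈ A ↔ v * g ∈ A) : IsClosed A := by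
  rw [← isOpen_compl_iff, isOpen_iff_forall_mem_open]
  intro g hg
  refine ⟨(fun v : Γ => v * g) '' (V : Set Γ), ?_, ?_, ⟨1, V.one_mem, one_mul g⟩⟩
  · rintro _ ⟨v, hv, rfl⟩ hvg
    exact hg ((h v hv g).2 hvg)
  · have : (fun v : Γ => v * g) '' (V : Set Γ) = (Homeomorph.mulRight g) '' (V : Set Γ) := rfl
    rw [this]
    exact (Homeomorph.mulRight g).isOpenMap _ hV

end Clopen

/-! ### `V`-stability of the set of primes where a class survives -/

section Stability

variable [IsTopologicalGroup Γ] {P : Type w} [MulAction Γ P]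

/-- For a locally constant `2`-cocycle `y` on `V₁ ⊇ V` and `v ∈ V`: if `y` bounds on
`D (v • p) ∩ V` then it bounds on `D p ∩ V` (conjugation by `v` carries one subgroup to the other
and changes `y` by a coboundary on `V₁`, `cocycle_conj_sub_coboundary`).
[cite: NeukirchSchmidtWingberg2008, Prop (12.1.9)] -/
theorem coboundary_stabilizer_of_smul {V V₁ : Subgroup Γ} (hVV₁ : V ≤ V₁) {y : Γ → Γ → R}
    (hylc : IsLocallyConstant (fun q : V₁ × V₁ => y q.1 q.2))
    (hycoc : ∀ a ∈ V₁, ∀ b ∈ V₁, ∀ c ∈ V₁, y a b + y (a * b) c = y b c + y a (b * c))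
    {v : Γ} (hv : v ∈ V) (p : P)
    (h : ∃ β : Γ → R, IsLocallyConstant (fun s : ↥(MulAction.stabilizer Γ (v • p) ⊓ V) => β s) ∧
      ∀ a ∈ MulAction.stabilizer Γ (v • p) ⊓ V, ∀ b ∈ MulAction.stabilizer Γ (v • p) ⊓ V,
        y a b = β a + β b - β (a * b)) :
    ∃ β : Γ → R, IsLocallyConstant (fun s : ↥(MulAction.stabilizer Γ p ⊓ V) => β s) ∧
      ∀ a ∈ MulAction.stabilizer Γ p ⊓ V, ∀ b ∈ MulAction.stabilizer Γ p ⊓ V,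
        y a b = β a + β b - β (a * b) := by
  obtain ⟨β, hβ, hyβ⟩ := h
  set S : Subgroup Γ := MulAction.stabilizer Γ p ⊓ V with hSdef
  set S' : Subgroup Γ := MulAction.stabilizer Γ (v • p) ⊓ V with hS'def
  -- conjugation `a ↦ v a v⁻¹` maps `S` into `S'`
  have hconj : ∀ a ∈ S, v * a * v⁻¹ ∈ S' := by
    intro a ha
    have h1 : v * a * v⁻¹ ∈ MulAction.stabilizer Γ (v • p) := by
      rw [MulAction.mem_stabilizer_iff, mul_smul, mul_smul, inv_smul_smul,
        MulAction.mem_stabilizer_iff.1 (Subgroup.mem_inf.1 ha).1]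
    exact Subgroup.mem_inf.2 ⟨h1, V.mul_mem (V.mul_mem hv (Subgroup.mem_inf.1 ha).2) (V.inv_mem hv)⟩
  have hvV₁ : v⁻¹ ∈ V₁ := V₁.inv_mem (hVV₁ hv)
  -- the homotopy `γ a = y (v⁻¹, v a v⁻¹) - y (a, v⁻¹)`
  set γ : Γ → R := fun a => y v⁻¹ (v⁻¹⁻¹ * a * v⁻¹) - y a v⁻¹ with hγdef
  refine ⟨fun a => β (v * a * v⁻¹) - γ a, ?_, fun a ha b hb => ?_⟩
  · -- local constancy on `S`
    have hc : Continuous fun s : S => (⟨v * s * v⁻¹, hconj s s.2⟩ : S') := by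
      apply Continuous.subtype_mk
      exact (continuous_const.mul continuous_subtype_val).mul continuous_const
    have h1 : IsLocallyConstant fun s : S => β (v * s * v⁻¹) :=
      hβ.comp_continuous hc
    have hSV₁ : S ≤ V₁ := fun a ha => hVV₁ ha.2
    have h2 : IsLocallyConstant fun s : S => y v⁻¹ (v⁻¹⁻¹ * s * v⁻¹) :=
      hylc.comp_continuous (f := fun s : S => ((⟨v⁻¹, hvV₁⟩ : V₁),
        (⟨v⁻¹⁻¹ * s * v⁻¹, V₁.mul_mem (V₁.mul_mem (V₁.inv_mem hvV₁) (hSV₁ s.2)) hvV₁⟩ : V₁)))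
        (by
          apply continuous_const.prodMk
          apply Continuous.subtype_mk
          exact (continuous_const.mul continuous_subtype_val).mul continuous_const)
    have h3 : IsLocallyConstant fun s : S => y s v⁻¹ :=
      hylc.comp_continuous (f := fun s : S => ((⟨s, hSV₁ s.2⟩ : V₁), (⟨v⁻¹, hvV₁⟩ : V₁)))
        (by
          apply Continuous.prodMk _ continuous_const
          exact Continuous.subtype_mk continuous_subtype_val _)
    exact (h1.comp₂ (h2.comp₂ h3 (· - ·)) (· - ·))
  · have key := cocycle_conj_sub_coboundary (S := V₁) hycoc hvV₁ (hVV₁ (Subgroup.mem_inf.1 ha).2)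
      (hVV₁ (Subgroup.mem_inf.1 hb).2)
    have hβab := hyβ _ (hconj a ha) _ (hconj b hb)
    have hmul : v * a * v⁻¹ * (v * b * v⁻¹) = v * (a * b) * v⁻¹ := by group
    rw [hmul] at hβab
    simp only [inv_inv] at key
    rw [hβab] at key
    simp only [hγdef, inv_inv]
    linear_combination -key

/-- `V`-stability of `{p : y|_{D p ∩ V} bounds}`: for `v ∈ V`, `y` bounds on `D (v • p) ∩ V` iff it
bounds on `D p ∩ V`. [cite: NeukirchSchmidtWingberg2008, Prop (12.1.9)] -/
theorem coboundary_stabilizer_smul_iff {V V₁ : Subgroup Γ} (hVV₁ : V ≤ V₁) {y : Γ → Γ → R}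
    (hylc : IsLocallyConstant (fun q : V₁ × V₁ => y q.1 q.2))
    (hycoc : ∀ a ∈ V₁, ∀ b ∈ V₁, ∀ c ∈ V₁, y a b + y (a * b) c = y b c + y a (b * c))
    {v : Γ} (hv : v ∈ V) (p : P) :
    (∃ β : Γ → R, IsLocallyConstant (fun s : ↥(MulAction.stabilizer Γ (v • p) ⊓ V) => β s) ∧
      ∀ a ∈ MulAction.stabilizer Γ (v • p) ⊓ V, ∀ b ∈ MulAction.stabilizer Γ (v • p) ⊓ V,
        y a b = β a + β b - β (a * b)) ↔
    ∃ β : Γ → R, IsLocallyConstant (fun s : ↥(MulAction.stabilizer Γ p ⊓ V) => β s) ∧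
      ∀ a ∈ MulAction.stabilizer Γ p ⊓ V, ∀ b ∈ MulAction.stabilizer Γ p ⊓ V,
        y a b = β a + β b - β (a * b) := by
  refine ⟨coboundary_stabilizer_of_smul hVV₁ hylc hycoc hv p, fun h => ?_⟩
  have h' := coboundary_stabilizer_of_smul (V := V) hVV₁ hylc hycoc (V.inv_mem hv) (v • p)
  rw [inv_smul_smul] at h'
  exact h' h

end Stability

/-! ### The existence step of [NSW] (12.1.9) -/

section Existence

variable [IsTopologicalGroup Γ] [CompactSpace Γ] [TotallyDisconnectedSpace Γ]
variable {P : Type w} [MulAction Γ P]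
variable (Cob : Subgroup Γ → (Γ → Γ → R) → Prop)
  (hCob : ∀ (S : Subgroup Γ) (f : Γ → Γ → R), Cob S f ↔
    ∃ β : Γ → R, IsLocallyConstant (fun s : S => β s) ∧ ∀ a ∈ S, ∀ b ∈ S, f a b = β a + β b - β (a * b))

include hCob

/-- **EXISTENCE step of Neukirch's theorem** ([NSW] Prop. (12.1.9), abstract form).  Let the profinite
group `Γ` act on `P` (stabilisers `D p`), let `π : P → ι` ("the rational prime below") have every
fibre a finite union of `Γ`-orbits ("finitely many primes over a rational prime"), and assume Hasse
injectivity (AxH) and finite support (AxF) for locally constant `2`-cocycles on the open subgroups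
`V ≤ V₀`.  Let `H' ≤ V₀` be closed and `x` a locally constant `2`-cocycle on `H'` which does not
bound.  Then `x` extends to a cocycle `y` on an open `V₁` (`H' ≤ V₁ ≤ V₀`) and there is a prime `p`
with `y|_{D p ∩ V} ≠ 0` for EVERY open `V` with `H' ≤ V ≤ V₁`.  Proof: `y` from
`exists_open_extension_of_cocycle`; `T(V) = {p : y|_{D p ∩ V} ≠ 0}` is non-empty by (AxH),
decreasing in `V`, `V`-stable, and lies over the finite set of rational primes (AxF) at `V₁`; a
rational prime common to all `π(T(V))` exists by finiteness, and over it the closed sets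
`{g : g • q_j ∈ T(V)}` have a common point by compactness of `Γ`.
[cite: NeukirchSchmidtWingberg2008, Prop (12.1.9)] -/
theorem exists_prime_forall_not_coboundary
    {ι : Type*} (π : P → ι)
    (hfib : ∀ i : ι, ∃ s : Finset P, ∀ p : P, π p = i → ∃ q ∈ s, ∃ g : Γ, g • q = p)
    {V₀ : Subgroup Γ} (hV₀ : IsOpen (V₀ : Set Γ))
    (AxH : ∀ V : Subgroup Γ, IsOpen (V : Set Γ) → V ≤ V₀ → ∀ f : Γ → Γ → R,
      IsLocallyConstant (fun q : V × V => f q.1 q.2) →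
      (∀ a ∈ V, ∀ b ∈ V, ∀ c ∈ V, f a b + f (a * b) c = f b c + f a (b * c)) →
      (∀ p : P, Cob (MulAction.stabilizer Γ p ⊓ V) f) → Cob V f)
    (AxF : ∀ V : Subgroup Γ, IsOpen (V : Set Γ) → V ≤ V₀ → ∀ f : Γ → Γ → R,
      IsLocallyConstant (fun q : V × V => f q.1 q.2) →
      (∀ a ∈ V, ∀ b ∈ V, ∀ c ∈ V, f a b + f (a * b) c = f b c + f a (b * c)) →
      Set.Finite {i : ι | ∃ p : P, π p = i ∧ ¬ Cob (MulAction.stabilizer Γ p ⊓ V) f})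
    {H' : Subgroup Γ} (hH' : IsClosed (H' : Set Γ)) (hH'V₀ : H' ≤ V₀)
    {x : Γ → Γ → R} (hxlc : IsLocallyConstant (fun q : H' × H' => x q.1 q.2))
    (hxcoc : ∀ a ∈ H', ∀ b ∈ H', ∀ c ∈ H', x a b + x (a * b) c = x b c + x a (b * c))
    (hx : ¬ Cob H' x) :
    ∃ (p : P) (V₁ : Subgroup Γ), IsOpen (V₁ : Set Γ) ∧ H' ≤ V₁ ∧ V₁ ≤ V₀ ∧
      ∃ y : Γ → Γ → R, IsLocallyConstant (fun q : V₁ × V₁ => y q.1 q.2) ∧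
        (∀ a ∈ V₁, ∀ b ∈ V₁, ∀ c ∈ V₁, y a b + y (a * b) c = y b c + y a (b * c)) ∧
        (∀ a ∈ H', ∀ b ∈ H', y a b = x a b) ∧
        ∀ V : Subgroup Γ, IsOpen (V : Set Γ) → H' ≤ V → V ≤ V₁ →
          ¬ Cob (MulAction.stabilizer Γ p ⊓ V) y := by
  classical
  obtain ⟨V₁, hV₁, hH'V₁, hV₁V₀, y, hylc, hycoc, hyx⟩ :=
    exists_open_extension_of_cocycle hH' hV₀ hH'V₀ hxlc hxcoc
  -- `y` does not bound on any open `V` between `H'` and `V₁`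
  have hyV : ∀ V : Subgroup Γ, IsOpen (V : Set Γ) → H' ≤ V → V ≤ V₁ → ¬ Cob V y := by
    intro V hV hH'V hVV₁ hyb
    rw [hCob] at hyb
    apply hx
    rw [hCob]
    obtain ⟨β, hβ, hβy⟩ := coboundary_mono hH'V hyb
    exact ⟨β, hβ, fun a ha b hb => (hyx a ha b hb).symm.trans (hβy a ha b hb)⟩
  -- the directed set of levels
  let 𝒱 := {V : Subgroup Γ // IsOpen (V : Set Γ) ∧ H' ≤ V ∧ V ≤ V₁}
  let Vtop : 𝒱 := ⟨V₁, hV₁, hH'V₁, le_rfl⟩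
  haveI : Nonempty 𝒱 := ⟨Vtop⟩
  have hdir𝒱 : ∀ V W : 𝒱, ∃ M : 𝒱, M.1 ≤ V.1 ∧ M.1 ≤ W.1 := fun V W =>
    ⟨⟨V.1 ⊓ W.1, V.2.1.inter W.2.1, le_inf V.2.2.1 W.2.2.1, inf_le_left.trans V.2.2.2⟩,
      inf_le_left, inf_le_right⟩
  -- `T V` = primes at which `y` survives at level `V`
  let T : 𝒱 → Set P := fun V => {p | ¬ Cob (MulAction.stabilizer Γ p ⊓ V.1) y}
  have hTanti : ∀ V W : 𝒱, W.1 ≤ V.1 → T W ⊆ T V := by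
    intro V W hWV p hp hpV
    refine hp ?_
    rw [hCob] at hpV ⊢
    exact coboundary_mono (inf_le_inf_left _ hWV) hpV
  have hTne : ∀ V : 𝒱, (T V).Nonempty := by
    intro V
    by_contra h
    have hall : ∀ p : P, Cob (MulAction.stabilizer Γ p ⊓ V.1) y := fun p => by
      by_contra hp
      exact h ⟨p, hp⟩
    exact hyV V.1 V.2.1 V.2.2.1 V.2.2.2 (AxH V.1 V.2.1 (V.2.2.2.trans hV₁V₀) y
      (lc₂_mono V.2.2.2 hylc) (coc_mono V.2.2.2 hycoc) hall)
  -- a rational prime lying under `T V` for every level `V`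
  have hQ := AxF V₁ hV₁ hV₁V₀ y hylc hycoc
  obtain ⟨i, hi⟩ := exists_mem_forall_of_subset_finite hQ (fun V : 𝒱 => π '' T V)
    (by
      rintro V _ ⟨p, hp, rfl⟩
      exact ⟨p, rfl, hTanti Vtop V V.2.2.2 hp⟩)
    (fun V => (hTne V).image π)
    (fun V W => by
      obtain ⟨M, h1, h2⟩ := hdir𝒱 V W
      exact ⟨M, Set.image_mono (hTanti V M h1), Set.image_mono (hTanti W M h2)⟩)
  obtain ⟨s, hs⟩ := hfib i
  -- the closed sets `C V = {g : g • q ∈ T V for some q ∈ s}` in `Γ`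
  let C : 𝒱 → Set Γ := fun V => ⋃ q ∈ s, {g : Γ | g • q ∈ T V}
  have hCne : ∀ V, (C V).Nonempty := by
    intro V
    obtain ⟨p, hp, hpi⟩ := hi V
    obtain ⟨q, hq, g, rfl⟩ := hs p hpi
    exact ⟨g, Set.mem_biUnion hq hp⟩
  have hCanti : ∀ V W : 𝒱, W.1 ≤ V.1 → C W ⊆ C V := by
    intro V W h g hg
    obtain ⟨q, hq, hgq⟩ := Set.mem_iUnion₂.1 hg
    exact Set.mem_biUnion hq (hTanti V W h hgq)
  have hCdir : Directed (· ⊇ ·) C := fun V W => by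
    obtain ⟨M, h1, h2⟩ := hdir𝒱 V W
    exact ⟨M, hCanti V M h1, hCanti W M h2⟩
  have hCcl : ∀ V, IsClosed (C V) := by
    intro V
    refine s.finite_toSet.isClosed_biUnion fun q _ => ?_
    refine isClosed_of_forall_mul_mem_iff V.2.1 fun v hv g => ?_
    change ¬ Cob (MulAction.stabilizer Γ (g • q) ⊓ V.1) y ↔
      ¬ Cob (MulAction.stabilizer Γ ((v * g) • q) ⊓ V.1) y
    rw [mul_smul, hCob, hCob, coboundary_stabilizer_smul_iff V.2.2.2 hylc hycoc hv (g • q)]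
  obtain ⟨g, hg⟩ := IsCompact.nonempty_iInter_of_directed_nonempty_isCompact_isClosed C hCdir hCne
    (fun V => (hCcl V).isCompact) hCcl
  rw [Set.mem_iInter] at hg
  -- a common `q ∈ s`
  obtain ⟨q, hq⟩ := exists_mem_forall_of_subset_finite s.finite_toSet
    (fun V : 𝒱 => {q : P | q ∈ s ∧ g • q ∈ T V}) (fun V q hq => hq.1)
    (fun V => by
      obtain ⟨q, hq, h⟩ := Set.mem_iUnion₂.1 (hg V)
      exact ⟨q, hq, h⟩)
    (fun V W => by
      obtain ⟨M, h1, h2⟩ := hdir𝒱 V W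
      exact ⟨M, fun q hq => ⟨hq.1, hTanti V M h1 hq.2⟩, fun q hq => ⟨hq.1, hTanti W M h2 hq.2⟩⟩)
  refine ⟨g • q, V₁, hV₁, hH'V₁, hV₁V₀, y, hylc, hycoc, hyx, fun V hV hH'V hVV₁ => ?_⟩
  exact (hq ⟨V, hV, hH'V, hVV₁⟩).2

end Existence

end Literature.NumberTheory.GaloisRepresentations.NeukirchAbstract

-- (enqueue re-land 2026-08-26T14:1xZ: byte-identical declarations; trailing comment only, to rebuild the
-- stranded olean of this module — STRANDED-ACCEPT class, w4-d014 10:34:09Z pattern)
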